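import Summits.Parity.GeneralizedHardyLittlewood.Theorems.GreenTaoLevelTwoMNTwoLocalQuadratic
import Summits.Parity.GeneralizedHardyLittlewood.Theorems.GreenTaoLevelTwoMNTwoProgressionAveraging
import Summits.Parity.GeneralizedHardyLittlewood.Theorems.GreenTaoLevelTwoMNTwoWeylProgression
import Summits.Parity.GeneralizedHardyLittlewood.Theorems.GreenTaoLevelTwoMNTwoWeightRemoval
import Summits.Parity.GeneralizedHardyLittlewood.Theorems.GreenTaoLevelTwoMNTwoPropNineteenGlue

/-!
# Route `GreenTaoLevelTwo`, crux `MNTwo` (stmt-Parity-21276), line `birth`, stub `stub_mnVertical`: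
# large type I sum ⇒ `φ''(dt,dt)` is major arc (GT 2008b Lemma 23)

Block V4 / H2 of the `stub_mnVertical` census (B. Green, T. Tao, *Quadratic uniformity of the
Möbius function*, Ann. Inst. Fourier 58 (2008) = arXiv:math/0606087, §10, Lemma 23 "Large Type I
sum implies major arc": if `|𝔼_{N/d<w≤2N/d} ψ(dw)e(φ(dw))| ≳ 1` then there are `Q ≲ 1`, `ε ≳ 1`
with `‖φ''(dt,dt)‖_{ℝ/ℤ,Q} ≲ L⁻²` whenever `L ≥ 1` and `‖dt‖_g ≤ ε/L`).

ABSTRACT, def-free form in the vocabulary of `…MNTwoLocalQuadratic` (gauge `ν`, here also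
dominating `|n|/N`), with the phase valued in `ℝ/ℤ = UnitAddCircle` (cube hypothesis `hφ` on the
gauge ball `B(n₀,R)`), the weight `ψ` nonnegative, bounded by `B`, `ν`-Lipschitz and supported in
`B(n₀,ρ)`, and ALL CONSTANTS EXPLICIT: the largeness parameter `δ` replaces `≳ 1`, the output is
`1 ≤ q ≤ C(512B²/δ²)^A`, `‖q•φ''(dt,dt)‖ ≤ 2C(512B²/δ²)^A/L²` with the absolute `A, C` of the tree's
inverse Weyl inequality (`…MNTwoWeylProgression.weyl_choose_two_progression`).  The proof is the
printed one: averaging over progressions `w + tl` (`…MNTwoProgressionAveraging`), discarding the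
slowly varying weight (`…MNTwoWeightRemoval`), Corollary 20 (`…MNTwoLocalQuadratic.phase_on_progression`)
and Weyl's inequality.

* `coe_choose_two_phase` — the Cor-20 phase lifted from `ℝ` to `ℝ/ℤ`;
* `norm_nsmul_eq_distInt` — `‖q•(θ : ℝ/ℤ)‖ = distInt(qθ)`;
* `typeI_major_arc` — **Lemma 23**.

References: [GreenTao2008QuadraticMobius] arXiv:math/0606087 §10, Lemma 23; Cor. 20; App. A.
-/

noncomputable section

open Finset Real
open scoped FourierTransform

namespace Summit.Parity.GeneralizedHardyLittlewood.GreenTaoLevelTwoMNTwoTypeIMajorArc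

open Literature.NumberTheory.Sieve.Vinogradov (distInt distInt_eq_norm_coe)
open Summit.Parity.GeneralizedHardyLittlewood.GreenTaoLevelTwoMNTwoLocalQuadratic
  (gauge_nsmul_le phase_on_progression)
open Summit.Parity.GeneralizedHardyLittlewood.GreenTaoLevelTwoMNTwoProgressionAveraging
  (exists_large_progression)
open Summit.Parity.GeneralizedHardyLittlewood.GreenTaoLevelTwoMNTwoWeylProgression
  (weyl_choose_two_progression)
open Summit.Parity.GeneralizedHardyLittlewood.GreenTaoLevelTwoMNTwoWeightRemoval
  (norm_sum_phase_ge_of_weight)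
open Summit.Parity.GeneralizedHardyLittlewood.GreenTaoLevelTwoMNTwoPropNineteenGlue
  (toCircle_coe_eq_fourierChar)

/-- The Cor-20 phase, lifted: `↑((l choose 2)θ + αl + β) = (l choose 2)•↑θ + l•↑α + ↑β` in `ℝ/ℤ`.
[folklore] -/
theorem coe_choose_two_phase (θ α β : ℝ) (l : ℕ) :
    ((((l.choose 2 : ℕ) : ℝ) * θ + α * l + β : ℝ) : UnitAddCircle) =
      (l.choose 2) • ((θ : ℝ) : UnitAddCircle) + l • ((α : ℝ) : UnitAddCircle) +
        ((β : ℝ) : UnitAddCircle) := by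
  rw [show ((l.choose 2 : ℕ) : ℝ) * θ + α * l + β = (l.choose 2) • θ + l • α + β by
    rw [nsmul_eq_mul, nsmul_eq_mul]; ring]
  rfl

/-- `‖q • (θ : ℝ/ℤ)‖ = distInt(qθ)`. [folklore] -/
theorem norm_nsmul_eq_distInt (q : ℕ) (θ : ℝ) :
    ‖q • ((θ : ℝ) : UnitAddCircle)‖ = distInt (q * θ) := by
  rw [distInt_eq_norm_coe, ← nsmul_eq_mul]
  rfl

/-- **Large type I sum implies major arc (GT 2008b Lemma 23), explicit abstract form.**
There are absolute `A ∈ ℕ`, `C ≥ 1` such that the following holds.  Let `ν` be a gauge on `ℤ`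
(`ν 0 = 0`, `ν ≥ 0`, subadditive) dominating `|n|/N` (`|n| ≤ N ν(n)`, `N ≥ 1`); let
`φ : ℤ → ℝ/ℤ` be locally quadratic on the gauge ball `B(n₀, R)` (eight-point hypothesis); let
`0 < ε`, `ρ + 5ε ≤ R`; let `ψ : ℤ → [0, B]` (`B ≥ 1`) be supported in `B(n₀, ρ)` and `ν`-Lipschitz;
let `0 < δ ≤ 1` with `16Bε ≤ δ`; let `d ≠ 0` and `a ≤ b` with `ψ(dw) = 0` for `w ∉ [a,b]` and
`b − a + 1 ≤ 3N/|d|`.  If the type I sum is large,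
`δN/|d| ≤ ‖∑_{w ∈ [a,b]} ψ(dw) e(φ(dw))‖`, then for every `L ≥ 1` and every `t` with
`L ν(dt) ≤ ε` there is `1 ≤ q ≤ C(512B²/δ²)^A` with
`‖q • φ''(dt,dt)‖_{ℝ/ℤ} ≤ 2C(512B²/δ²)^A / L²`, where
`φ''(h,h) = φ(n₀+2h) − 2φ(n₀+h) + φ(n₀)`. [cite: GreenTao2008QuadraticMobius, Lemma 23] -/
theorem typeI_major_arc :
    ∃ (A : ℕ) (C : ℝ), 1 ≤ C ∧
      ∀ (ν : ℤ → ℝ), ν 0 = 0 → (∀ x, 0 ≤ ν x) → (∀ x y, ν (x + y) ≤ ν x + ν y) →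
      ∀ (N : ℕ), 1 ≤ N → (∀ n : ℤ, |(n : ℝ)| ≤ N * ν n) →
      ∀ (φ : ℤ → UnitAddCircle) (n₀ : ℤ) (R ρ ε : ℝ),
        (∀ n a b c : ℤ, ν (n - n₀) < R → ν (n + a - n₀) < R → ν (n + b - n₀) < R →
          ν (n + c - n₀) < R → ν (n + a + b - n₀) < R → ν (n + a + c - n₀) < R →
          ν (n + b + c - n₀) < R → ν (n + a + b + c - n₀) < R →
          φ (n + a + b + c) - φ (n + a + b) - φ (n + a + c) - φ (n + b + c)
            + φ (n + a) + φ (n + b) + φ (n + c) - φ n = 0) →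
        0 < ε → ρ + 5 * ε ≤ R →
      ∀ (ψ : ℤ → ℝ) (B : ℝ), 1 ≤ B → (∀ n, 0 ≤ ψ n) → (∀ n, ψ n ≤ B) →
        (∀ n, ψ n ≠ 0 → ν (n - n₀) < ρ) → (∀ n n', |ψ n - ψ n'| ≤ ν (n - n')) →
      ∀ (δ : ℝ), 0 < δ → δ ≤ 1 → 16 * B * ε ≤ δ →
      ∀ (d : ℤ), d ≠ 0 → ∀ (a b : ℤ), a ≤ b → (∀ w, w ∉ Icc a b → ψ (d * w) = 0) →
        ((b - a + 1 : ℤ) : ℝ) ≤ 3 * N / |(d : ℝ)| →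
        δ * N / |(d : ℝ)| ≤
          ‖∑ w ∈ Icc a b, ((ψ (d * w) : ℝ) : ℂ) * (AddCircle.toCircle (φ (d * w)) : ℂ)‖ →
      ∀ (L : ℕ), 1 ≤ L → ∀ (t : ℤ), (L : ℝ) * ν (d * t) ≤ ε →
        ∃ q : ℕ, 1 ≤ q ∧ (q : ℝ) ≤ C * (512 * B ^ 2 / δ ^ 2) ^ A ∧
          ‖q • (φ (n₀ + d * t + d * t) - φ (n₀ + d * t) - φ (n₀ + d * t) + φ n₀)‖ ≤
            2 * (C * (512 * B ^ 2 / δ ^ 2) ^ A / (L : ℝ) ^ 2) := by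
  obtain ⟨A, C, hC1, hW⟩ := weyl_choose_two_progression
  refine ⟨A, C, hC1, ?_⟩
  intro ν hν0 hνnn hνadd N hN hνN φ n₀ R ρ ε hφ hε hR ψ B hB1 hψ0 hψB hsupp hlip δ hδ hδ1 hεδ
    d hd a b hab hsuppw hlen hlarge L hL t hLt
  -- basic positivity
  have hNr : (0 : ℝ) < N := by exact_mod_cast hN
  have hdr : (0 : ℝ) < |(d : ℝ)| := abs_pos.mpr (by exact_mod_cast hd)
  have hLr : (1 : ℝ) ≤ L := by exact_mod_cast hL
  have hB0 : (0 : ℝ) < B := by linarith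
  have hεδ' : ε ≤ δ / 16 := by
    rw [le_div_iff₀ (by norm_num : (0:ℝ) < 16)]
    nlinarith
  have hε2 : ε ≤ 1 / 2 := by linarith
  -- the summand along `w`
  set f : ℤ → ℂ := fun w => ((ψ (d * w) : ℝ) : ℂ) * (AddCircle.toCircle (φ (d * w)) : ℂ)
    with hf
  have hf0 : ∀ w, w ∉ Icc a b → f w = 0 := fun w hw => by
    simp only [hf, hsuppw w hw, Complex.ofReal_zero, zero_mul]
  -- Step 1: `|t| L ≤ ε N / |d|`
  have htL : |(t : ℝ)| * L ≤ ε * N / |(d : ℝ)| := by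
    rw [le_div_iff₀ hdr]
    have h1 : |(d : ℝ) * t| ≤ N * ν (d * t) := by
      have := hνN (d * t); push_cast at this; exact this
    calc |(t : ℝ)| * L * |(d : ℝ)| = L * |(d : ℝ) * t| := by rw [abs_mul]; ring
      _ ≤ L * (N * ν (d * t)) := mul_le_mul_of_nonneg_left h1 (by positivity)
      _ = N * ((L : ℝ) * ν (d * t)) := by ring
      _ ≤ N * ε := mul_le_mul_of_nonneg_left hLt hNr.le
      _ = ε * N := mul_comm _ _
  -- Step 2: averaging over progressions and pigeonholing a base point `w₀`
  obtain ⟨w₀, -, hprog⟩ := exists_large_progression hab hf0 t L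
  have hcardW : (#(Icc (a - |t| * L) (b + |t| * L)) : ℝ) ≤ 4 * N / |(d : ℝ)| := by
    rw [Int.card_Icc]
    have h0 : 0 ≤ b + |t| * (L : ℤ) + 1 - (a - |t| * (L : ℤ)) := by
      have := abs_nonneg t; nlinarith
    have e : (((b + |t| * (L : ℤ) + 1 - (a - |t| * (L : ℤ))).toNat : ℕ) : ℝ) =
        ((b + |t| * (L : ℤ) + 1 - (a - |t| * (L : ℤ)) : ℤ) : ℝ) := by
      exact_mod_cast Int.toNat_of_nonneg h0
    rw [e]
    push_cast
    have h2 : ((b : ℝ) - a + 1) ≤ 3 * N / |(d : ℝ)| := by exact_mod_cast hlen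
    have h3 : 2 * (|(t : ℝ)| * L) ≤ N / |(d : ℝ)| := by
      calc 2 * (|(t : ℝ)| * L) ≤ 2 * (ε * N / |(d : ℝ)|) := by linarith
        _ = (2 * ε) * (N / |(d : ℝ)|) := by ring
        _ ≤ 1 * (N / |(d : ℝ)|) := mul_le_mul_of_nonneg_right (by linarith) (by positivity)
        _ = N / |(d : ℝ)| := one_mul _
    have e2 : (b : ℝ) + |(t : ℝ)| * L + 1 - (a - |(t : ℝ)| * L) =
        ((b : ℝ) - a + 1) + 2 * (|(t : ℝ)| * L) := by ring
    rw [e2]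
    calc ((b : ℝ) - a + 1) + 2 * (|(t : ℝ)| * L) ≤ 3 * N / |(d : ℝ)| + N / |(d : ℝ)| :=
          add_le_add h2 h3
      _ = 4 * N / |(d : ℝ)| := by ring
  have hprogL : δ * L / 4 ≤ ‖∑ l ∈ Icc (1 : ℕ) L, f (w₀ + t * l)‖ := by
    have h1 : (L : ℝ) * (δ * N / |(d : ℝ)|) ≤ (4 * N / |(d : ℝ)|) *
        ‖∑ l ∈ Icc (1 : ℕ) L, f (w₀ + t * l)‖ :=
      calc (L : ℝ) * (δ * N / |(d : ℝ)|) ≤ (L : ℝ) * ‖∑ w ∈ Icc a b, f w‖ :=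
            mul_le_mul_of_nonneg_left hlarge (by positivity)
        _ ≤ (#(Icc (a - |t| * L) (b + |t| * L)) : ℝ) * ‖∑ l ∈ Icc (1 : ℕ) L, f (w₀ + t * l)‖ :=
            hprog
        _ ≤ (4 * N / |(d : ℝ)|) * ‖∑ l ∈ Icc (1 : ℕ) L, f (w₀ + t * l)‖ :=
            mul_le_mul_of_nonneg_right hcardW (norm_nonneg _)
    have hpos : 0 < N / |(d : ℝ)| := by positivity
    have e : (L : ℝ) * (δ * N / |(d : ℝ)|) = (δ * L) * (N / |(d : ℝ)|) := by ring
    have e' : (4 * N / |(d : ℝ)|) * ‖∑ l ∈ Icc (1 : ℕ) L, f (w₀ + t * l)‖ =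
        (4 * ‖∑ l ∈ Icc (1 : ℕ) L, f (w₀ + t * l)‖) * (N / |(d : ℝ)|) := by ring
    rw [e, e'] at h1
    have := le_of_mul_le_mul_right h1 hpos
    linarith
  -- Step 3: the progression `n + l h`, `n = d w₀`, `h = d t`; discard the weight
  set n : ℤ := d * w₀ with hn
  set h : ℤ := d * t with hh
  set c : ℕ → ℂ := fun l => (AddCircle.toCircle (φ (n + (l : ℤ) * h)) : ℂ) with hc
  have hfl : ∀ l : ℕ, f (w₀ + t * l) = ((ψ (n + (l : ℤ) * h) : ℝ) : ℂ) * c l := by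
    intro l
    simp only [hf, hc, hn, hh]
    rw [show d * (w₀ + t * (l : ℤ)) = d * w₀ + (l : ℤ) * (d * t) by ring]
  have hsum_eq : ∑ l ∈ Icc (1 : ℕ) L, f (w₀ + t * l) =
      ∑ l ∈ Icc (1 : ℕ) L, ((ψ (n + (l : ℤ) * h) : ℝ) : ℂ) * c l :=
    Finset.sum_congr rfl fun l _ => hfl l
  rw [hsum_eq] at hprogL
  have hc1 : ∀ l ∈ Icc (1 : ℕ) L, ‖c l‖ ≤ 1 := fun l _ => by
    simp only [hc, Circle.norm_coe, le_refl]
  have hνh : (L : ℝ) * ν h = (L : ℝ) * ν (d * t) := by rw [hh]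
  have hu : ∀ l ∈ Icc (1 : ℕ) L, |ψ (n + (l : ℤ) * h) - ψ n| ≤ ε := by
    intro l hl
    have hl' : (l : ℝ) ≤ L := by exact_mod_cast (Finset.mem_Icc.mp hl).2
    calc |ψ (n + (l : ℤ) * h) - ψ n| ≤ ν (n + (l : ℤ) * h - n) := hlip _ _
      _ = ν ((l : ℤ) * h) := by rw [add_sub_cancel_left]
      _ ≤ l * ν h := gauge_nsmul_le ν hν0 hνadd h l
      _ ≤ L * ν h := mul_le_mul_of_nonneg_right hl' (hνnn h)
      _ ≤ ε := by rw [hνh]; exact hLt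
  have hwr := norm_sum_phase_ge_of_weight (Icc (1 : ℕ) L) (fun l => ψ (n + (l : ℤ) * h)) c
    (u₀ := ψ n) (δ := ε) (B := ψ n) (X := δ * L / 4) hc1 hu
    (by rw [abs_of_nonneg (hψ0 n)]) hprogL
  rw [Nat.card_Icc, Nat.add_sub_cancel] at hwr
  -- `δ L / 8 ≤ ψ(n) ‖∑ c‖`
  have hmain : δ * L / 8 ≤ ψ n * ‖∑ l ∈ Icc (1 : ℕ) L, c l‖ := by
    have h1 : ε * L ≤ δ * L / 16 := by
      have := mul_le_mul_of_nonneg_right hεδ' (show (0 : ℝ) ≤ L by positivity)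
      linarith
    have h2 : 0 ≤ δ * L := by positivity
    linarith
  -- hence `ψ n ≠ 0`, so `n ∈ B(n₀, ρ)`
  have hcsum : ‖∑ l ∈ Icc (1 : ℕ) L, c l‖ ≤ L := by
    calc ‖∑ l ∈ Icc (1 : ℕ) L, c l‖ ≤ ∑ l ∈ Icc (1 : ℕ) L, ‖c l‖ := norm_sum_le _ _
      _ ≤ ∑ _l ∈ Icc (1 : ℕ) L, (1 : ℝ) := Finset.sum_le_sum hc1
      _ = L := by simp
  have hψn : ψ n ≠ 0 := by
    intro h0
    rw [h0, zero_mul] at hmain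
    have : (0 : ℝ) < δ * L / 8 := by positivity
    linarith
  have hnball : ν (n - n₀) < ρ := hsupp n hψn
  -- `η L ≤ ‖∑ c‖` with `η = δ/(8B)`
  set η : ℝ := δ / (8 * B) with hη
  have hη0 : 0 < η := by positivity
  have hη1 : η ≤ 1 := by
    rw [hη, div_le_one (by positivity)]; nlinarith
  have hηL : η * L ≤ ‖∑ l ∈ Icc (1 : ℕ) L, c l‖ := by
    rw [hη, div_mul_eq_mul_div, div_le_iff₀ (by positivity)]
    have := mul_le_mul_of_nonneg_left (hψB n) (norm_nonneg (∑ l ∈ Icc (1 : ℕ) L, c l))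
    nlinarith
  -- Step 4: Corollary 20 on the progression
  have hLν : (L : ℝ) * ν h ≤ ε := by rw [hνh]; exact hLt
  have hνh1 : ν h ≤ ε := by
    have : ν h ≤ (L : ℝ) * ν h := by
      have := mul_le_mul_of_nonneg_right hLr (hνnn h); linarith
    linarith
  have hP := phase_on_progression ν hν0 hνnn hνadd φ hφ (n := n) (h := h) (r₁ := ρ + ε)
    (r₂ := 2 * ε) (L := L) (by linarith) (by linarith) (by linarith)
  -- lift the three `ℝ/ℤ` quantities to `ℝ`
  obtain ⟨θ, hθ⟩ : ∃ θ : ℝ, ((θ : ℝ) : UnitAddCircle) =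
      φ (n₀ + h + h) - φ (n₀ + h) - φ (n₀ + h) + φ n₀ := QuotientAddGroup.mk_surjective _
  obtain ⟨αr, hαr⟩ : ∃ αr : ℝ, ((αr : ℝ) : UnitAddCircle) = φ (n + h) - φ n :=
    QuotientAddGroup.mk_surjective _
  obtain ⟨β, hβ⟩ : ∃ β : ℝ, ((β : ℝ) : UnitAddCircle) = φ n := QuotientAddGroup.mk_surjective _
  have hcl : ∀ l ∈ Icc (1 : ℕ) L,
      c l = (𝐞 (((l.choose 2 : ℕ) : ℝ) * θ + αr * l + β) : ℂ) := by
    intro l hl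
    have hl' : l ≤ L := (Finset.mem_Icc.mp hl).2
    simp only [hc]
    rw [hP l hl', ← hαr, ← hθ, ← hβ, ← coe_choose_two_phase, toCircle_coe_eq_fourierChar]
  rw [Finset.sum_congr rfl hcl] at hηL
  -- Step 5: Weyl's inequality
  obtain ⟨q, hq1, hqC, hdist⟩ := hW η L θ αr β hη0 hη1 hL hηL
  have hηeq : 8 / η ^ 2 = 512 * B ^ 2 / δ ^ 2 := by
    rw [hη]; field_simp; ring
  rw [hηeq] at hqC hdist
  refine ⟨q, hq1, hqC, ?_⟩
  rw [← hθ, norm_nsmul_eq_distInt q θ]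
  exact hdist

end Summit.Parity.GeneralizedHardyLittlewood.GreenTaoLevelTwoMNTwoTypeIMajorArc
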